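import Summits.ABC.ABC.Theses.CuspFieldPencil
import Summits.ABC.ABC.Theorems.GoldenFieldClassNumberOne
import Summits.ABC.ABC.Theorems.CuspFieldPencilGoldenFromNFPencil
import Literature.NumberTheory.DiophantineGeometry.MatveevYuPlaceBoundsNumberField
import Literature.IUT.LogVolume.ArakelovDivisors
import Mathlib.NumberTheory.Padics.PadicVal.Basic
import HarnessLib

/-!
# Sketch (stub-ideation k=1, GEN 4 — FAMILY 1 RECOGNISE & IMPORT) for `stub_conjugateCuspTriple`
(crux stmt-ABC-26026 `GoldenCuspShadow`, route CuspFieldPencil).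

GEN-4 DELTA over the converged gen-3 plans (k1 `ConjK1G3`, k2 `SideaK2G3`, k3 `ConjugateK3G3`):
the stub VERBATIM is `UWHalf ∧ QSideRadSq`, and the K-side statement `QSideRadSq`
(`log H ≪ R^ε · rad(Q)²`) needs NO prime-decomposition law in `ℚ(√5)`: at a prime `p ∣ Q` one takes
ANY prime `𝔭 ⊇ (p)` of `𝓞_K` (exists in every Dedekind domain), uses `v_p(Q) ≤ ord_𝔭(Q)` and the crude
`N𝔭 ∣ p^{[K:ℚ]} = p²`, and pays `p²/log p` per prime — which is EXACTLY the stub's exponent pair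
`(2/3, 2/3)`: `min(m, q²) ≤ q^{2/3} m^{2/3}`. The sharper `N𝔭 = p` (k3's `Q5b`, needed only for the
exponent-`1/3` by-product `GoldenThird`) is isolated as ONE optional lemma `absNorm_eq_prime_of_dvd_quadForm`.
Statements only (`sorry` bodies) except small real-algebra facts and the compositions.
-/

set_option linter.dupNamespace false
set_option linter.unusedVariables false

namespace Summit.ABC.ABC.Cruxes.GoldenCuspShadow.ConjK1G4

open Summit.ABC.ABC.Theses.CuspFieldPencil
open Literature.NumberTheory.DiophantineGeometry.Dioph (matveev2000_linearFormsLog_nf yu2007_padicLogForm_logB_nf)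
open UniqueFactorizationMonoid NumberField IsDedekindDomain
open Literature.IUT.LogVolume (ord ord_mul ord_pow ord_pos_iff_mem ord_nonneg_of_isIntegral)

noncomputable section

/-! ### 0 · Integer-facing statements -/

/-- The registered stub signature, verbatim (payload.stub.signature). -/
def Sig : Prop :=
  ∀ ε : ℝ, 0 < ε → ∃ κ : ℝ, ∀ u w : ℤ, IsCoprime u w → u * w * (u ^ 2 - 11 * u * w - w ^ 2) ≠ 0 → Real.log (max (|(u : ℝ)|) (|(w : ℝ)|)) ≤ κ * (((UniqueFactorizationMonoid.radical (u * w * (u ^ 2 - 11 * u * w - w ^ 2))).natAbs : ℕ) : ℝ) ^ (ε : ℝ) * ((((UniqueFactorizationMonoid.radical (u ^ 2 - 11 * u * w - w ^ 2)).natAbs : ℕ) : ℝ) ^ (2 / 3 : ℝ) * (min (((UniqueFactorizationMonoid.radical u).natAbs : ℕ) : ℝ) (((UniqueFactorizationMonoid.radical w).natAbs : ℕ) : ℝ)) ^ (2 / 3 : ℝ))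

/-- `UWHalf` — VERBATIM the k2-gen-3 statement (`SideaK2G3.UWHalf`; `= ConjK1G3.UWMinRad` up to the
coercion `(ε : ℝ)`): the unconditional ℚ-line `log H ≤ κ_δ R^δ · min(rad u, rad w)`. -/
def UWHalf : Prop :=
  ∀ δ : ℝ, 0 < δ → ∃ κ : ℝ, ∀ u w : ℤ, IsCoprime u w → u * w * (u ^ 2 - 11 * u * w - w ^ 2) ≠ 0 →
    Real.log (max (|(u : ℝ)|) (|(w : ℝ)|)) ≤
      κ * (((radical (u * w * (u ^ 2 - 11 * u * w - w ^ 2))).natAbs : ℕ) : ℝ) ^ δ *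
        min (((radical u).natAbs : ℕ) : ℝ) (((radical w).natAbs : ℕ) : ℝ)

/-- `QNotSmall` — VERBATIM the k3-gen-3 statement (archimedean K-half, mod Matveev-NF):
`2 log H ≤ log|Q| + κ_δ rad(uw)^δ log(2 + log H)`. -/
def QNotSmall : Prop :=
  ∀ δ : ℝ, 0 < δ → ∃ κ : ℝ, ∀ u w : ℤ, IsCoprime u w → u * w * (u ^ 2 - 11 * u * w - w ^ 2) ≠ 0 →
    2 * Real.log (max (|(u : ℝ)|) (|(w : ℝ)|)) ≤
      Real.log (|((u ^ 2 - 11 * u * w - w ^ 2 : ℤ) : ℝ)|) +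
        κ * (((radical (u * w)).natAbs : ℕ) : ℝ) ^ δ *
          Real.log (2 + Real.log (max (|(u : ℝ)|) (|(w : ℝ)|)))

/-- NEW `QUpperSq` (non-archimedean K-half at CRUDE norm cost, mod Yu-NF, NO splitting law):
`log|Q| ≤ κ_δ rad(uw)^δ · rad(Q)² · log(2 + log H)`. -/
def QUpperSq : Prop :=
  ∀ δ : ℝ, 0 < δ → ∃ κ : ℝ, ∀ u w : ℤ, IsCoprime u w → u * w * (u ^ 2 - 11 * u * w - w ^ 2) ≠ 0 →
    Real.log (|((u ^ 2 - 11 * u * w - w ^ 2 : ℤ) : ℝ)|) ≤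
      κ * (((radical (u * w)).natAbs : ℕ) : ℝ) ^ δ *
        (((radical (u ^ 2 - 11 * u * w - w ^ 2)).natAbs : ℕ) : ℝ) ^ 2 *
          Real.log (2 + Real.log (max (|(u : ℝ)|) (|(w : ℝ)|)))

/-- NEW `QSideRadSq` (the integer-facing K-datum at exponent 2): `log H ≤ κ_ε R^ε · rad(Q)²`. -/
def QSideRadSq : Prop :=
  ∀ ε : ℝ, 0 < ε → ∃ κ : ℝ, ∀ u w : ℤ, IsCoprime u w → u * w * (u ^ 2 - 11 * u * w - w ^ 2) ≠ 0 →
    Real.log (max (|(u : ℝ)|) (|(w : ℝ)|)) ≤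
      κ * (((radical (u * w * (u ^ 2 - 11 * u * w - w ^ 2))).natAbs : ℕ) : ℝ) ^ (ε : ℝ) *
        (((radical (u ^ 2 - 11 * u * w - w ^ 2)).natAbs : ℕ) : ℝ) ^ 2

/-- The per-prime CRUDE Yu step as a statement (`YuCrude`): for every prime `p ∣ Q`
(no `p ∤ 10`, no splitting hypothesis), `v_p(Q) · log p ≤ κ_δ rad(uw)^δ · (p²/log p) · log(2 + log H)`. -/
def YuCrude : Prop :=
  ∀ δ : ℝ, 0 < δ → ∃ κ : ℝ, ∀ u w : ℤ, IsCoprime u w → u * w * (u ^ 2 - 11 * u * w - w ^ 2) ≠ 0 →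
    ∀ p : ℕ, p.Prime → (p : ℤ) ∣ u ^ 2 - 11 * u * w - w ^ 2 →
      (padicValInt p (u ^ 2 - 11 * u * w - w ^ 2) : ℝ) * Real.log p ≤
        κ * (((radical (u * w)).natAbs : ℕ) : ℝ) ^ δ * ((p : ℝ) ^ 2 / Real.log p) *
          Real.log (2 + Real.log (max (|(u : ℝ)|) (|(w : ℝ)|)))

/-! ### 1 · GENERIC number-field bookkeeping (any number field `K`; F0–F5 PROVED here, sorry-free —
the certificate that the finite-place step needs NO splitting law; candidates for ONE tree file
`Summits/ABC/ABC/Theorems/CuspFieldPencilPlaceBookkeeping.lean`, `--supports stmt-ABC-26026`) -/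

/-- F0 (XS, PROVED): `N((p)) = p^{[K:ℚ]}` (`Ideal.absNorm_span_singleton`, `Algebra.norm_algebraMap`,
`RingOfIntegers.rank`). [folklore] -/
theorem absNorm_span_natCast (K : Type*) [Field K] [NumberField K] (p : ℕ) :
    Ideal.absNorm (Ideal.span {((p : ℕ) : 𝓞 K)}) = p ^ Module.finrank ℚ K := by
  rw [Ideal.absNorm_span_singleton]
  have h1 : ((p : ℕ) : 𝓞 K) = algebraMap ℤ (𝓞 K) (p : ℤ) := by simp
  rw [h1, Algebra.norm_algebraMap, NumberField.RingOfIntegers.rank]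
  simp [Int.natAbs_pow]

/-- F1 (XS, PROVED): above every rational prime there is a finite place — NO decomposition law needed
(`(p)` is a proper non-zero ideal since `N((p)) = p^{[K:ℚ]} ≠ 1`; `Ideal.exists_le_maximal`). [folklore] -/
theorem exists_place_mem_prime (K : Type*) [Field K] [NumberField K] (p : ℕ) (hp : p.Prime) :
    ∃ 𝔭 : HeightOneSpectrum (𝓞 K), ((p : ℕ) : 𝓞 K) ∈ 𝔭.asIdeal := by
  have hne : Ideal.span {((p : ℕ) : 𝓞 K)} ≠ ⊤ := by
    intro h
    have h1 := absNorm_span_natCast K p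
    rw [h, Ideal.absNorm_top] at h1
    have hn : 0 < Module.finrank ℚ K := Module.finrank_pos
    have : p ^ Module.finrank ℚ K ≠ 1 := Ne.symm (ne_of_lt (Nat.one_lt_pow hn.ne' hp.one_lt))
    exact this h1.symm
  obtain ⟨M, hM, hle⟩ := Ideal.exists_le_maximal _ hne
  have hp0 : ((p : ℕ) : 𝓞 K) ≠ 0 := by exact_mod_cast hp.ne_zero
  have hMbot : M ≠ ⊥ := by
    intro hb
    have : ((p : ℕ) : 𝓞 K) ∈ M := hle (Ideal.mem_span_singleton_self _)
    rw [hb, Ideal.mem_bot] at this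
    exact hp0 this
  exact ⟨⟨M, hM.isPrime, hMbot⟩, hle (Ideal.mem_span_singleton_self _)⟩

/-- F2 (XS, PROVED): such a place has `N𝔭 ∣ p^{[K:ℚ]}` (`Ideal.absNorm_dvd_absNorm_of_le` + F0). [folklore] -/
theorem absNorm_dvd_prime_pow (K : Type*) [Field K] [NumberField K] (p : ℕ) (hp : p.Prime)
    (𝔭 : HeightOneSpectrum (𝓞 K)) (h𝔭 : ((p : ℕ) : 𝓞 K) ∈ 𝔭.asIdeal) :
    Ideal.absNorm 𝔭.asIdeal ∣ p ^ Module.finrank ℚ K := by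
  rw [← absNorm_span_natCast K p]
  apply Ideal.absNorm_dvd_absNorm_of_le
  rw [Ideal.span_singleton_le_iff_mem]
  exact h𝔭

/-- F3 (S, PROVED): `v_p(z) ≤ ord_𝔭(z)` for a non-zero integer `z` and ANY place `𝔭 ∋ p`
(`z = p^{v} z'` by `padicValInt_dvd`; `ord_𝔭(p) ≥ 1` by `ord_pos_iff_mem`; `ord_𝔭(z') ≥ 0` by
`ord_nonneg_of_isIntegral`; `ord_mul`, `ord_pow`). [folklore] -/
theorem padicValInt_le_ord (K : Type*) [Field K] [NumberField K] (p : ℕ) (hp : p.Prime)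
    (𝔭 : HeightOneSpectrum (𝓞 K)) (h𝔭 : ((p : ℕ) : 𝓞 K) ∈ 𝔭.asIdeal) (z : ℤ) (hz : z ≠ 0) :
    (padicValInt p z : ℤ) ≤ ord K 𝔭 ((z : ℤ) : K) := by
  haveI : Fact p.Prime := ⟨hp⟩
  obtain ⟨z', hz'⟩ := padicValInt_dvd (p := p) z
  set v := padicValInt p z with hv
  have hz'0 : z' ≠ 0 := by
    rintro rfl; simp at hz'; exact hz hz'
  have hp0 : ((p : ℕ) : 𝓞 K) ≠ 0 := by exact_mod_cast hp.ne_zero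
  have hpK : (((p : ℕ) : 𝓞 K) : K) = ((p : ℕ) : K) := by simp
  have hz'K : ((z' : 𝓞 K) : K) = ((z' : ℤ) : K) := by simp
  have hpK0 : ((p : ℕ) : K) ≠ 0 := by exact_mod_cast hp.ne_zero
  have hz'K0 : ((z' : ℤ) : K) ≠ 0 := by exact_mod_cast hz'0
  have hordp : 1 ≤ ord K 𝔭 ((p : ℕ) : K) := by
    have := (ord_pos_iff_mem K 𝔭 ((p : ℕ) : 𝓞 K) hp0).mpr h𝔭
    rw [hpK] at this
    omega
  have hordz' : 0 ≤ ord K 𝔭 ((z' : ℤ) : K) := by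
    rw [← hz'K]; exact ord_nonneg_of_isIntegral K 𝔭 (z' : 𝓞 K)
  have hcast : ((z : ℤ) : K) = ((p : ℕ) : K) ^ v * ((z' : ℤ) : K) := by
    rw [hz']; push_cast; ring
  rw [hcast, ord_mul K 𝔭 (pow_ne_zero _ hpK0) hz'K0, ord_pow]
  nlinarith

/-- F4 (XS, PROVED): an integer coprime to `p` is a `𝔭`-unit for EVERY `𝔭 ∋ p` (`a p + b z = 1 ⇒ 1 ∈ 𝔭`).
Used at `z = w` (`gcd(w, Q) = 1`, `p ∣ Q`): `ord_𝔭(x_±) = ord_𝔭(Λ_±)`. [folklore] -/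
theorem ord_eq_zero_of_isCoprime (K : Type*) [Field K] [NumberField K] (p : ℕ) (hp : p.Prime)
    (𝔭 : HeightOneSpectrum (𝓞 K)) (h𝔭 : ((p : ℕ) : 𝓞 K) ∈ 𝔭.asIdeal) (z : ℤ) (hz : IsCoprime (p : ℤ) z) :
    ord K 𝔭 ((z : ℤ) : K) = 0 := by
  have hz0 : z ≠ 0 := by
    rintro rfl
    have := IsCoprime.isUnit_of_dvd' hz (dvd_refl _) (dvd_zero _)
    have h2 : (p : ℤ).natAbs = 1 := Int.isUnit_iff_natAbs_eq.mp this
    simp at h2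
    exact hp.one_lt.ne' h2
  have hzK : ((z : 𝓞 K) : K) = ((z : ℤ) : K) := by simp
  have h0 : 0 ≤ ord K 𝔭 ((z : ℤ) : K) := by
    rw [← hzK]; exact ord_nonneg_of_isIntegral K 𝔭 (z : 𝓞 K)
  rcases h0.lt_or_eq with hpos | heq
  · exfalso
    have hz0' : (z : 𝓞 K) ≠ 0 := by exact_mod_cast hz0
    rw [← hzK] at hpos
    have hmem : (z : 𝓞 K) ∈ 𝔭.asIdeal := (ord_pos_iff_mem K 𝔭 (z : 𝓞 K) hz0').mp hpos
    obtain ⟨a, b, hab⟩ := hz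
    have h1 : (1 : 𝓞 K) ∈ 𝔭.asIdeal := by
      have : ((a : ℤ) : 𝓞 K) * ((p : ℕ) : 𝓞 K) + ((b : ℤ) : 𝓞 K) * ((z : ℤ) : 𝓞 K) = 1 := by
        exact_mod_cast congrArg (fun t : ℤ => (t : 𝓞 K)) hab
      rw [← this]
      exact 𝔭.asIdeal.add_mem (𝔭.asIdeal.mul_mem_left _ h𝔭) (𝔭.asIdeal.mul_mem_left _ hmem)
    exact 𝔭.isPrime.ne_top ((Ideal.eq_top_iff_one _).mpr h1)
  · exact heq.symm

/-- F5 (XS, PROVED): the crude per-prime cost. If `N ∣ p²` and `N ≠ 1` then `N/log N ≤ p²/log p`. [folklore] -/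
theorem div_log_le_sq_div_log {p N : ℕ} (hp : p.Prime) (hN : N ∣ p ^ 2) (hN1 : N ≠ 1) :
    (N : ℝ) / Real.log N ≤ (p : ℝ) ^ 2 / Real.log p := by
  obtain ⟨i, hi, rfl⟩ := (Nat.dvd_prime_pow hp).mp hN
  have hp1 : (1 : ℝ) < p := by exact_mod_cast hp.one_lt
  have hlog : 0 < Real.log p := Real.log_pos hp1
  interval_cases i
  · simp at hN1
  · simp only [pow_one]
    have : (p : ℝ) ≤ (p : ℝ) ^ 2 := by nlinarith
    exact div_le_div_of_nonneg_right this hlog.le |>.trans le_rfl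
  · push_cast
    rw [Real.log_pow]
    push_cast
    have h2 : Real.log p ≤ 2 * Real.log p := by linarith
    exact div_le_div_of_nonneg_left (by positivity) hlog h2

/-- F6 (XS): `Σ_{p ∣ n} p² ≤ (∏_{p ∣ n} p)²` (all prime factors `≥ 2`; `a² + b² ≤ a²b²` for `a, b ≥ 2`). [folklore] -/
theorem sum_sq_primeFactors_le (n : ℕ) :
    ∑ p ∈ n.primeFactors, (p : ℝ) ^ 2 ≤ ((∏ p ∈ n.primeFactors, p : ℕ) : ℝ) ^ 2 := by
  sorry

/-! ### 2 · The golden field: the two forms and the crude finite step -/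

section Golden

variable [Fact (∀ r : ℚ, r ^ 2 ≠ (1 : ℚ) + 1 * r)]

local notation "K" => QuadraticAlgebra ℚ 1 1

/-- F7 (XS, PROVED via the tree's `GoldenFromNFPencil.formTwo_mul_formThree` BY NAME): with `θ = ω`, `x₊ = u + (−3 − 5θ) w`, `x₋ = u + (−8 + 5θ) w`:
`x₊ · x₋ = Q` in `K` (`GoldenFromNFPencil.prod_forms` pattern, `ω·ω = ω + 1`), hence for `Q ≠ 0`
`ord_𝔭(Q) = ord_𝔭(x₊) + ord_𝔭(x₋)`; and `x₊ = ω⁵ w · Λ₊`, `x₋ = −ω⁻⁵ w · Λ₋` with the Λ-FORMS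
`Λ₊ = (u/w) ω⁻⁵ − 1`, `Λ₋ = ((−u)/w) ω⁵ − 1`, so `ord_𝔭(x_±) = ord_𝔭(Λ_±)` whenever `ord_𝔭(w) = 0`. -/
theorem quadForm_eq_mul_conj (u w : ℚ) :
    ((u ^ 2 - 11 * u * w - w ^ 2 : ℚ) : K) =
      ((u : K) + (-3 - 5 * (QuadraticAlgebra.omega : K)) * (w : K)) *
        ((u : K) + (-8 + 5 * (QuadraticAlgebra.omega : K)) * (w : K)) := by
  have hω : (QuadraticAlgebra.omega : K) * QuadraticAlgebra.omega = QuadraticAlgebra.omega + 1 := by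
    rw [QuadraticAlgebra.omega_mul_omega_eq_add, add_comm]; simp
  have h := Summit.ABC.ABC.Theorems.GoldenFromNFPencil.formTwo_mul_formThree
    (QuadraticAlgebra.omega : K) ((u : ℚ) : K) ((w : ℚ) : K) hω
  push_cast
  rw [← h]; ring

/-- Y1 (M, THE load-bearing finite step, mod Yu-NF; replaces k3's Q5b+Q5c): `YuCrude`.
DIRECT INSTANCE of `Dioph.evertseGyory2022_prop_4_2_4_finite_nf_of_yu hY` at `K`, at the place `𝔭 ∋ p` of F1
(NO splitting analysis), for BOTH Λ-forms `Λ_±` of F7 (`κ = Option (Option ι)`, `ι` = prime support of `|uw|`: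
`α = p ↦ (p : K)`, `b = v_p(u) − v_p(w)`; `α none = ω`, `b = ∓5`; one slot `α = −1` for the sign; pad to
`card ≥ 2`; `B = 5 + 2 log₂ H`): `−c₁₀(n,2)(N𝔭/log N𝔭) Ω log B < log‖Λ_±‖_𝔭 = −ord_𝔭(Λ_±) log N𝔭`
(`adicAbv_eq_absNorm_zpow`); then `v_p(Q) log p ≤ ord_𝔭(Q) log N𝔭` (F3, `p ≤ N𝔭`)
`= (ord_𝔭 Λ₊ + ord_𝔭 Λ₋) log N𝔭` (F7, F4 at `z = w`: `p ∤ w` since `gcd(w, Q) = 1`)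
`< 2 c₁₀ Ω log B · N𝔭/log N𝔭 ≤ 2 c₁₀ Ω log B · p²/log p` (F2 + F5); heights `logHeight₁ (p : K)/2 = log p`
(`logHeight₁_algebraMap`, `logHeight₁_natCast_prime`), `c₁₀(n,2) Ω ≤ C_δ rad(uw)^δ`
(`exists_pow_card_primeFactors_le_mul_rpow`, `exists_prod_log_primeFactors_le_mul_rpow`). -/
theorem yuCrude_of_yu (hY : yu2007_padicLogForm_logB_nf) : YuCrude := by
  sorry

/-- G1 (M−, OPTIONAL upgrade lemma — only for the exponent-1/3 by-product `GoldenThird` of k3, not for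
the stub): for coprime `u, w`, a prime `p ≠ 5` dividing `Q` is never inert, so EVERY place `𝔭 ∋ p` has
`N𝔭 = p` (if `N𝔭 = p² = N((p))` then `𝔭 = (p)` is prime and divides `x₊ x₋`, so `z = x_±/p ∈ 𝓞_K`; but
`(z − z̄)² = 125 w²/p² ∈ ℤ` forces `p ∣ w`, and `Tr z = (2u − 11w)/p ∈ ℤ` forces `p ∣ u` — contradiction;
no integral basis of `𝓞_K` is needed). With G1 the cost in Y1 drops to `2p/log p` and `QUpperSq`
sharpens to k3's `QUpper`. [folklore] -/
theorem absNorm_eq_prime_of_dvd_quadForm [NumberField K] (u w : ℤ) (huw : IsCoprime u w)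
    (p : ℕ) (hp : p.Prime) (hp5 : p ≠ 5) (hpQ : (p : ℤ) ∣ u ^ 2 - 11 * u * w - w ^ 2)
    (hQ : u ^ 2 - 11 * u * w - w ^ 2 ≠ 0)
    (𝔭 : HeightOneSpectrum (𝓞 K)) (h𝔭 : ((p : ℕ) : 𝓞 K) ∈ 𝔭.asIdeal) :
    Ideal.absNorm 𝔭.asIdeal = p := by
  sorry

end Golden

/-! ### 3 · Assemblies (real arithmetic; each ≤ 1 prover cycle) -/

/-- Y2 (S): sum Y1 over `p ∣ Q`: `log|Q| = Σ_{p∣Q} v_p(Q) log p` (`Nat.log`-free: `Real.log` of the prime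
factorisation, pattern `log_eq_sum_factorization_mul_log`) and `Σ_{p∣Q} p²/log p ≤ (log 2)⁻¹ rad(Q)²` (F6,
`Int.radical_eq_prod_primeFactors` / `GoldenFromNFPencil.natAbs_radical_prod` bookkeeping). -/
theorem qUpperSq_of_yuCrude (h : YuCrude) : QUpperSq := by
  sorry

/-- E1 (S, self-improvement): `QNotSmall ∧ QUpperSq ⇒ QSideRadSq`. With `L = log(2 + log H)`,
`q = rad Q`, `r = rad(uw)`: `2 log H ≤ κ₂ r^δ q² L + κ₁ r^δ L ≤ A·L`, `A = (κ₁+κ₂) R^δ q²` (`r, q ≤ R`,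
`R = rad(uwQ) = r·q` by coprimality); `x ≤ A log(2+x) ⇒ x ≤ 2A log(A+11)` (k3's `selfImprove` /
tree `Literature.Barriers.ABC.le_of_le_mul_log_max`) and `log(A + 11) ≤ C_δ R^δ` (`Real.log_le_rpow_div`);
take `δ = ε/3`. -/
theorem qSideRadSq_of (h₁ : QNotSmall) (h₂ : QUpperSq) : QSideRadSq := by
  sorry

/-- E2a (XS, PROVED): the exponent algebra of the stub — `min(m, q²) ≤ q^{2/3} · m^{2/3}` for `m ≥ 1`, `q ≥ 1`. -/
theorem min_le_rpow_mul_rpow {m q : ℝ} (hm : 1 ≤ m) (hq : 1 ≤ q) :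
    min m (q ^ 2) ≤ q ^ (2 / 3 : ℝ) * m ^ (2 / 3 : ℝ) := by
  have hm0 : 0 < m := by linarith
  have hq0 : 0 < q := by linarith
  rcases le_or_gt m (q ^ 2) with h | h
  · -- `min = m = m^{1/3} m^{2/3} ≤ (q²)^{1/3} m^{2/3}`
    rw [min_eq_left h]
    have h13 : m ^ (1 / 3 : ℝ) ≤ (q ^ 2) ^ (1 / 3 : ℝ) :=
      Real.rpow_le_rpow hm0.le h (by norm_num)
    have hq2 : (q ^ 2) ^ (1 / 3 : ℝ) = q ^ (2 / 3 : ℝ) := by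
      rw [← Real.rpow_natCast q 2, ← Real.rpow_mul hq0.le]; norm_num
    have hsplit : m = m ^ (1 / 3 : ℝ) * m ^ (2 / 3 : ℝ) := by
      rw [← Real.rpow_add hm0]; norm_num
    calc m = m ^ (1 / 3 : ℝ) * m ^ (2 / 3 : ℝ) := hsplit
      _ ≤ (q ^ 2) ^ (1 / 3 : ℝ) * m ^ (2 / 3 : ℝ) := by
          gcongr
      _ = q ^ (2 / 3 : ℝ) * m ^ (2 / 3 : ℝ) := by rw [hq2]
  · -- `min = q² = (q²)^{1/3} (q²)^{2/3} ≤ q^{2/3} m^{2/3}`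
    rw [min_eq_right h.le]
    have hq20 : 0 < q ^ 2 := by positivity
    have h23 : (q ^ 2) ^ (2 / 3 : ℝ) ≤ m ^ (2 / 3 : ℝ) :=
      Real.rpow_le_rpow hq20.le h.le (by norm_num)
    have hq2 : (q ^ 2) ^ (1 / 3 : ℝ) = q ^ (2 / 3 : ℝ) := by
      rw [← Real.rpow_natCast q 2, ← Real.rpow_mul hq0.le]; norm_num
    have hsplit : q ^ 2 = (q ^ 2) ^ (1 / 3 : ℝ) * (q ^ 2) ^ (2 / 3 : ℝ) := by
      rw [← Real.rpow_add hq20]; norm_num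
    calc q ^ 2 = (q ^ 2) ^ (1 / 3 : ℝ) * (q ^ 2) ^ (2 / 3 : ℝ) := hsplit
      _ ≤ (q ^ 2) ^ (1 / 3 : ℝ) * m ^ (2 / 3 : ℝ) := by gcongr
      _ = q ^ (2 / 3 : ℝ) * m ^ (2 / 3 : ℝ) := by rw [hq2]

/-- E2 (S): `UWHalf ∧ QSideRadSq ⇒ Sig` — both at `δ = ε`, `κ := max κ₁ κ₂ ⊔ 0`,
`log H ≤ κ R^ε min(m, q²) ≤ κ R^ε q^{2/3} m^{2/3}` (E2a; `m = min(rad u, rad w) ≥ 1`, `q = rad Q ≥ 1`). -/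
theorem sig_of_uwHalf_of_qSideRadSq (h₁ : UWHalf) (h₂ : QSideRadSq) : Sig := by
  sorry

/-- A1 (k3-gen-3's Q4/Q4d, restated for the net composition; mod Matveev-NF): `QNotSmall`.
Cleaner assembly than k3's: `log|Q| = log|x₊| + log|x₋|` with `|x₊| = φ⁵|w|·|Λ₊(u,w)| = |u|·|Λ₊'(w,u)|` and
`|x₋| = φ⁻⁵|w|·|Λ₋(u,w)| = |u|·|Λ₋'(w,u)|`, each `−log|Λ| ≤ T := κ_δ rad(uw)^δ log(2+log H)` by ONE lemma
`matveevStep` (k3 Q4d) applied four times ⇒ `log|Q| ≥ 2 log|w| − 2T` and `≥ 2 log|u| − 2T`. -/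
theorem qNotSmall_of_matveev (hM : matveev2000_linearFormsLog_nf) : QNotSmall := by
  sorry

/-- NET (kernel-checked composition, sorry-free itself): the stub VERBATIM from the unconditional ℚ-line
statement `UWHalf` and the two standard trust roots Matveev-NF, Yu-NF — with NO splitting law of `ℚ(√5)`. -/
theorem sig_of_facts (hU : UWHalf) (hM : matveev2000_linearFormsLog_nf)
    (hY : yu2007_padicLogForm_logB_nf) : Sig :=
  haveI : Fact (∀ r : ℚ, r ^ 2 ≠ (1 : ℚ) + 1 * r) := ⟨Summit.ABC.ABC.Theorems.GoldenField.golden_fact⟩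
  sig_of_uwHalf_of_qSideRadSq hU
    (qSideRadSq_of (qNotSmall_of_matveev hM) (qUpperSq_of_yuCrude (yuCrude_of_yu hY)))

/-! ### 4 · Sanity (`decide`/`norm_num`): the residual-regime witnesses and the crude cost -/

/-- The unit orbit: `Q(11,1) = −1`, `Q(122,11) = 1`, `Q(1353,122) = −1` (Regime II lives here). -/
example : (11:ℤ)^2 - 11*11*1 - 1^2 = -1 ∧ (122:ℤ)^2 - 11*122*11 - 11^2 = 1 ∧
    (1353:ℤ)^2 - 11*1353*122 - 122^2 = -1 := by norm_num

/-- `5`-adic sanity: `4Q = (2u − 11w)² − 125 w²`, so `5 ∣ Q ⇒ 25 ∣ Q` and `ν₅(Q) ∈ {0, 2, 3}` for coprime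
`u, w` (e.g. `Q(23,1) = 275 = 5²·11`, `Q(1,7) = −125`); `p = 5` is NOT special for Y1 (`𝔭 = (√5)`, `N𝔭 = 5`),
and `Q(12,1) = 11` shows split primes occur. -/
example : (12:ℤ)^2 - 11*12*1 - 1^2 = 11 ∧ (23:ℤ)^2 - 11*23*1 - 1^2 = 5^2 * 11 ∧
    (1:ℤ)^2 - 11*1*7 - 7^2 = -(5^3) := by norm_num

end

end Summit.ABC.ABC.Cruxes.GoldenCuspShadow.ConjK1G4
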